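import Mathlib
import Summits.Ventures.HodgeRepro2.T5AdicCompletionGaloisInvariance
import Summits.Ventures.HodgeRepro2.T5AdicCompletionResidueField
import Summits.Ventures.HodgeRepro2.T5AdicCompletionConductor

/-!
# Mathlib's completion integers `O_Kv` are `𝔪`-adically complete, hence Henselian

FOUNDATIONS for the N5 lane: the ring of integers `O_Kv = v.adicCompletionIntegers K` of a
number-field completion is `IsAdicComplete (maximalIdeal O_Kv) O_Kv` — Hausdorff by the Krull
intersection theorem (`Ideal.iInf_pow_eq_bot_of_isLocalRing`, `O_Kv` is a Noetherian local ring),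
precomplete by Cantor's intersection theorem in the compact `O_Kv` (the sets
`{L | ϖ^n ∣ L − f n}` are closed, decreasing and non-empty) — so that Mathlib's
`IsAdicComplete.henselianRing` makes `O_Kv` a `HenselianLocalRing` (instances `isAdicComplete`,
`henselianLocalRing`).  HENSEL'S LEMMA is then available at every finite place: a simple root of a
monic polynomial modulo `𝔪` lifts to a root (`exists_isRoot_of_eval_mem_maximalIdeal`); in
particular a unit whose residue is a square is a square when `2` is a unit
(`exists_sq_eq_of_sq_sub_mem_maximalIdeal`) — the input of the tame ramified norm computation
(route/T5-route-2.md (A8a) / (A11), rows 52 / 97 of route/LEAN-ANNEX-p4.md).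

Declaration per README §8(d): «uses an L-value-free non-vanishing device: NO».
-/

namespace Summit.Ventures.HodgeRepro2.T5AdicCompletionHenselian

open IsDedekindDomain HeightOneSpectrum WithZero Polynomial

section ValuedTopology

variable {R : Type*} [Ring R] {Γ₀ : Type*} [LinearOrderedCommGroupWithZero Γ₀] [Valued R Γ₀]

/-- `{y | γ < v y}` is open (the valuation is locally constant away from `0`). -/
theorem isOpen_setOf_lt_val (γ : Γ₀) : IsOpen {y : R | γ < Valued.v y} := by
  rw [isOpen_iff_mem_nhds]
  intro y₀ hy₀
  have h0 : Valued.v y₀ ≠ 0 := ne_of_gt (lt_of_le_of_lt zero_le hy₀)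
  refine Filter.mem_of_superset (Valued.locally_const h0) fun y hy => ?_
  simp only [Set.mem_setOf_eq] at hy ⊢
  rw [hy]
  exact hy₀

/-- `{y | v y ≤ γ}` is closed. -/
theorem isClosed_setOf_val_le (γ : Γ₀) : IsClosed {y : R | Valued.v y ≤ γ} := by
  have : {y : R | Valued.v y ≤ γ} = {y : R | γ < Valued.v y}ᶜ := by
    ext y
    simp only [Set.mem_setOf_eq, Set.mem_compl_iff, not_lt]
  rw [this]
  exact (isOpen_setOf_lt_val γ).isClosed_compl

end ValuedTopology

variable {K : Type*} [Field K] [NumberField K] (v : HeightOneSpectrum (NumberField.RingOfIntegers K))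

/-- Membership in `I • ⊤` is membership in `I` (for a ring acting on itself). -/
theorem mem_smul_top_iff (I : Ideal (adicCompletionIntegers K v)) (x : adicCompletionIntegers K v) :
    x ∈ I • (⊤ : Submodule (adicCompletionIntegers K v) (adicCompletionIntegers K v)) ↔ x ∈ I := by
  rw [Ideal.smul_top_eq_map]
  simp

/-- A unit of `O_Kv` has valuation `1`. -/
theorem val_coe_units_eq_one (x : (adicCompletionIntegers K v)ˣ) :
    Valued.v ((x : adicCompletionIntegers K v) : adicCompletion K v) = 1 := by
  have hle : Valued.v ((x : adicCompletionIntegers K v) : adicCompletion K v) ≤ 1 :=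
    (mem_adicCompletionIntegers _ _ _).mp (x : adicCompletionIntegers K v).2
  have hnot : ¬ Valued.v ((x : adicCompletionIntegers K v) : adicCompletion K v) < 1 := by
    rw [← T5AdicCompletionResidueField.mem_maximalIdeal_iff, IsLocalRing.mem_maximalIdeal,
      mem_nonunits_iff, not_not]
    exact x.isUnit
  exact le_antisymm hle (not_lt.mp hnot)

/-- THE DICTIONARY: `ϖ^n ∣ y` in `O_Kv` iff `v y ≤ exp (−n)`. -/
theorem pow_dvd_iff_val_le {ϖ : adicCompletionIntegers K v} (hϖ : Irreducible ϖ)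
    (y : adicCompletionIntegers K v) (n : ℕ) :
    ϖ ^ n ∣ y ↔ Valued.v (y : adicCompletion K v) ≤ exp (-(n : ℤ)) := by
  have hϖv : Valued.v (ϖ : adicCompletion K v) = exp (-1) :=
    (T5AdicCompletionConductor.irreducible_iff_val_eq_exp_neg_one v ϖ).mp hϖ
  constructor
  · rintro ⟨t, rfl⟩
    rw [Subring.coe_mul, map_mul]
    simp only [SubmonoidClass.coe_pow, map_pow, hϖv, ← exp_nsmul, smul_neg, nsmul_eq_mul, mul_one]
    calc exp (-(n : ℤ)) * Valued.v (t : adicCompletion K v) ≤ exp (-(n : ℤ)) * 1 :=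
          mul_le_mul' le_rfl ((mem_adicCompletionIntegers _ _ _).mp t.2)
      _ = exp (-(n : ℤ)) := mul_one _
  · intro h
    rcases eq_or_ne y 0 with rfl | hy
    · exact dvd_zero _
    obtain ⟨k, u, rfl⟩ := IsDiscreteValuationRing.eq_unit_mul_pow_irreducible hy hϖ
    have hk : Valued.v (((u : adicCompletionIntegers K v) * ϖ ^ k : adicCompletionIntegers K v) :
        adicCompletion K v) = exp (-(k : ℤ)) := by
      rw [Subring.coe_mul, map_mul, val_coe_units_eq_one, one_mul]
      simp only [SubmonoidClass.coe_pow, map_pow, hϖv, ← exp_nsmul, smul_neg, nsmul_eq_mul, mul_one]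
    rw [hk, exp_le_exp, neg_le_neg_iff, Nat.cast_le] at h
    exact Dvd.dvd.mul_left (pow_dvd_pow ϖ h) _

/-- Hausdorff: `⋂ 𝔪^n = 0` (Krull). -/
theorem isHausdorff :
    IsHausdorff (IsLocalRing.maximalIdeal (adicCompletionIntegers K v)) (adicCompletionIntegers K v) :=
  ⟨fun x hx => by
    have h : x ∈ ⨅ n : ℕ, (IsLocalRing.maximalIdeal (adicCompletionIntegers K v)) ^ n :=
      Ideal.mem_iInf.mpr fun n => (mem_smul_top_iff v _ _).mp (SModEq.zero.mp (hx n))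
    rwa [Ideal.iInf_pow_eq_bot_of_isLocalRing _ (IsLocalRing.maximalIdeal.isMaximal _).ne_top,
      Ideal.mem_bot] at h⟩

/-- The Cantor sets of a Cauchy sequence `f`: `{L | ϖ^n ∣ L − f n}`. -/
def cauchySet (ϖ : adicCompletionIntegers K v) (f : ℕ → adicCompletionIntegers K v) (n : ℕ) :
    Set (adicCompletionIntegers K v) :=
  {L | ϖ ^ n ∣ L - f n}

/-- The Cantor sets are closed. -/
theorem isClosed_cauchySet {ϖ : adicCompletionIntegers K v} (hϖ : Irreducible ϖ)
    (f : ℕ → adicCompletionIntegers K v) (n : ℕ) : IsClosed (cauchySet v ϖ f n) := by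
  have : cauchySet v ϖ f n = (fun L : adicCompletionIntegers K v => ((L - f n : adicCompletionIntegers K v) :
      adicCompletion K v)) ⁻¹' {y | Valued.v y ≤ exp (-(n : ℤ))} := by
    ext L
    simp only [cauchySet, Set.mem_setOf_eq, Set.mem_preimage]
    exact pow_dvd_iff_val_le v hϖ _ n
  rw [this]
  exact (isClosed_setOf_val_le _).preimage (continuous_subtype_val.comp (continuous_id.sub continuous_const))

/-- `O_Kv` is compact (row 82). -/
instance compactSpace : CompactSpace (adicCompletionIntegers K v) :=
  isCompact_iff_compactSpace.mp (T5AdicCompletionGaloisInvariance.isCompact_adicCompletionIntegers v)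

/-- Precomplete: every `𝔪`-adic Cauchy sequence converges (Cantor's intersection theorem). -/
theorem isPrecomplete :
    IsPrecomplete (IsLocalRing.maximalIdeal (adicCompletionIntegers K v)) (adicCompletionIntegers K v) := by
  refine ⟨fun f hf => ?_⟩
  obtain ⟨ϖ, hϖ⟩ := IsDiscreteValuationRing.exists_irreducible (adicCompletionIntegers K v)
  have hmem : ∀ (n : ℕ) (x : adicCompletionIntegers K v),
      x ∈ (IsLocalRing.maximalIdeal (adicCompletionIntegers K v)) ^ n ↔ ϖ ^ n ∣ x := by
    intro n x
    rw [hϖ.maximalIdeal_eq, Ideal.span_singleton_pow, Ideal.mem_span_singleton]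
  have hsub : ∀ n, cauchySet v ϖ f (n + 1) ⊆ cauchySet v ϖ f n := by
    intro n L hL
    have h1 : ϖ ^ n ∣ L - f (n + 1) := (pow_dvd_pow ϖ (Nat.le_succ n)).trans hL
    have h2 : ϖ ^ n ∣ f n - f (n + 1) :=
      (hmem n _).mp ((mem_smul_top_iff v _ _).mp (SModEq.sub_mem.mp (hf (Nat.le_succ n))))
    have : L - f n = (L - f (n + 1)) - (f n - f (n + 1)) := by ring
    rw [cauchySet, Set.mem_setOf_eq, this]
    exact dvd_sub h1 h2
  have hne : ∀ n, (cauchySet v ϖ f n).Nonempty := fun n => ⟨f n, by simp [cauchySet]⟩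
  obtain ⟨L, hL⟩ := IsCompact.nonempty_iInter_of_sequence_nonempty_isCompact_isClosed
    (cauchySet v ϖ f) hsub hne (isClosed_cauchySet v hϖ f 0).isCompact (isClosed_cauchySet v hϖ f)
  refine ⟨L, fun n => ?_⟩
  rw [Set.mem_iInter] at hL
  rw [SModEq.sub_mem, mem_smul_top_iff, hmem]
  have := hL n
  rw [cauchySet, Set.mem_setOf_eq] at this
  have e : f n - L = -(L - f n) := by ring
  rw [e]
  exact (dvd_neg).mpr this

/-- `O_Kv` IS `𝔪`-ADICALLY COMPLETE. -/
instance isAdicComplete :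
    IsAdicComplete (IsLocalRing.maximalIdeal (adicCompletionIntegers K v)) (adicCompletionIntegers K v) where
  toIsHausdorff := isHausdorff v
  toIsPrecomplete := isPrecomplete v

/-- `O_Kv` IS HENSELIAN (Mathlib's `IsAdicComplete.henselianRing` at the maximal ideal). -/
instance henselianLocalRing : HenselianLocalRing (adicCompletionIntegers K v) where
  is_henselian f hf a₀ h₁ h₂ :=
    HenselianRing.is_henselian (I := IsLocalRing.maximalIdeal (adicCompletionIntegers K v)) f hf a₀ h₁
      (h₂.map (Ideal.Quotient.mk _))

/-- HENSEL'S LEMMA at a finite place: a simple root modulo `𝔪` of a monic polynomial lifts. -/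
theorem exists_isRoot_of_eval_mem_maximalIdeal (f : (adicCompletionIntegers K v)[X]) (hf : f.Monic)
    (a₀ : adicCompletionIntegers K v) (h₁ : f.eval a₀ ∈ IsLocalRing.maximalIdeal (adicCompletionIntegers K v))
    (h₂ : IsUnit (f.derivative.eval a₀)) :
    ∃ a : adicCompletionIntegers K v, f.IsRoot a ∧ a - a₀ ∈ IsLocalRing.maximalIdeal (adicCompletionIntegers K v) :=
  HenselianLocalRing.is_henselian f hf a₀ h₁ h₂

/-- A unit whose residue is a square is a square, when `2` is a unit of `O_Kv` (residue
characteristic `≠ 2`): Hensel for `X² − u`. -/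
theorem exists_sq_eq_of_sq_sub_mem_maximalIdeal (u a₀ : adicCompletionIntegers K v)
    (h : a₀ ^ 2 - u ∈ IsLocalRing.maximalIdeal (adicCompletionIntegers K v)) (h2 : IsUnit (2 * a₀)) :
    ∃ a : adicCompletionIntegers K v, a ^ 2 = u ∧
      a - a₀ ∈ IsLocalRing.maximalIdeal (adicCompletionIntegers K v) := by
  have hd : (X ^ 2 - C u : (adicCompletionIntegers K v)[X]).derivative.eval a₀ = 2 * a₀ := by
    simp only [derivative_sub, derivative_X_pow, derivative_C, sub_zero, eval_mul, eval_C, eval_pow,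
      eval_X]
    norm_num
  obtain ⟨a, ha, ha₀⟩ := exists_isRoot_of_eval_mem_maximalIdeal v (X ^ 2 - C u)
    (monic_X_pow_sub_C u two_ne_zero) a₀ (by simpa using h) (by rw [hd]; exact h2)
  refine ⟨a, ?_, ha₀⟩
  simpa [sub_eq_zero] using ha

end Summit.Ventures.HodgeRepro2.T5AdicCompletionHenselian
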